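import Mathlib
import HarnessLib
import Literature.MathematicalPhysics.KineticTheory.VelocityFlipNoise
import Summits.AtomisticToContinuum.FouriersLaw.Theorems.VanishingNoiseTransferNoisyFourierBulkPositivityOfWitnessFamily

/-!
# The bath-refined level-`s` Thomson lower bound for the Abel pairing (line `abel-storage-decay`, crux
# `VanishingNoiseTransfer.NoisyFourier`, stmt-AtomisticToContinuum-11977; stubs B `stub_bulkAbelGKPositivity` and
# A7 `stub_thomsonFloor` = the `s`-uniform floor; lead c7, worker W7 "ThomsonBath")

`--supports stmt-AtomisticToContinuum-11977` file. Setting as in `…NoisyFourierBulkPositivityOfWitnessFamily`: the pinned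
anharmonic chain `𝐏 = pinnedChain ω₂ lam β γ` (parameters `> 0`), `T > 0`, `μ_T = 𝐏.gibbsMeasure L T`, `J = Σ_i j_i`
the total current, `σ_L(s) = ∫ J u dμ_T` the Abel–Green–Kubo pairing of a classical corrector `u` at `s > 0`
(`L_ε u = s u − J`, `L_ε = X + γS_B + εS`, `ε > 0`), `E(f) = Σ_i ‖f∘F_i − f‖²`, `P₀` the average over the `2^L`
momentum-sign patterns, `B = bathWeight L` (`B_0 = B_{L−1} = 1` for `L ≥ 2`).

The landed level-`s` Thomson bound `abelThomson_sq` charges the PATTERN DEFECT `P₀Xw` of a test function `w` to the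
storage `s‖P₀u‖²` of the corrector, at the price `‖P₀Xw‖²/s` — useless as `s → 0` unless `P₀Xw → 0`. The Thomson
witness of lead c7 has `P₀Xw = (p_0² − T) − (p_{L−1}² − T)` EXACTLY: a function of the two BATH momenta lying in
the eigenspace of the Ornstein–Uhlenbeck bath generator. Such a BATH-VALUED defect
`h = a(p_0² − T) + b(p_{L−1}² − T)` is charged instead to the corrector's bath DISSIPATION `γT‖∂_{p_b}u‖²` by
Gaussian integration by parts (`⟨u, p_b² − T⟩ = T⟨∂_{p_b}u, p_b⟩ ≤ T^{3/2}‖∂_{p_b}u‖`), at the `s`-UNIFORM price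
`(a² + b²)T²/γ`:

* `integral_mul_sq_momentum_sub_eq` — the Gibbs-measure Stein identity `∫ u (p_b² − T) dμ_T = T ∫ ∂_{p_b}u · p_b dμ_T`
  for `u ∈ C¹`, `u, ∂_{p_b}u ∈ L²(μ_T)` (= the bypass-bound helper `integral_mul_sq_sub_gibbsMeasure`);
* `mul_integral_mul_sq_momentum_sub_le` — its Young form `t·c·⟨u, p_b² − T⟩ ≤ (θ‖∂_{p_b}u‖² + θ⁻¹t²c²T³)/2`;
* `abelThomsonBath_linear`, `abelThomsonBath_sq` — the BATH-REFINED THOMSON BOUND: if `P₀Xw = h` pointwise, then for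
  every `t`, `t⟨J,w⟩ ≤ σ_L(s) + (t²/2)·Q^bath_s(w)`, hence `⟨J,w⟩² ≤ 2σ_L(s)·Q^bath_s(w)`, with
  `Q^bath_s(w) = s‖w‖² + (ε/2)E(w) + γTΣ_i B_i‖∂_{p_i}w‖² + ‖Xw − h‖²/ε + (a² + b²)T²/γ` — NO `1/s` term
  (`⟨u, Xw⟩ = ⟨u − P₀u, Xw − h⟩ + ⟨u, h⟩` since `P₀(Xw − h) = 0`; the first piece goes to the flip dissipation via the
  sector gap `4‖u − P₀u‖² ≤ E(u)` as in the landed proof, the second to `γT(‖∂_{p_0}u‖² + ‖∂_{p_{L−1}}u‖²)/2`; the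
  `u`-side adds up to `s‖u‖²/2 + (3ε/8)E(u) + γTΣ_i B_i‖∂_{p_i}u‖² ≤ σ_L(s)` by the energy identity);
* `helper_abelThomsonBath` — registered notation-free restatement of `abelThomsonBath_sq`.

References: Bernardin–Olla 2011 §5–6 (variational formulas for the flip-noisy chain); folklore (Stein's identity,
Thomson/dual Dirichlet principle). No definitions; axioms `propext`, `Classical.choice`, `Quot.sound` only.
-/

noncomputable section

open MeasureTheory Filter Topology
open scoped BigOperators
open Literature.MathematicalPhysics.KineticTheory.HeatConduction
open Summit.AtomisticToContinuum.FouriersLaw.Theorems.SuperadditiveResistance.DeviceLiouville (liouvilleOp bathOp)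
open Summit.AtomisticToContinuum.FouriersLaw.Theorems.SuperadditiveResistance.Kubo (memLp_partialP memLp_kinetic)
open Summit.AtomisticToContinuum.FouriersLaw.Theorems.SuperadditiveResistance.KuboPlain
  (generator_eq_liouvilleOp_add_bathOp)
open Summit.AtomisticToContinuum.FouriersLaw.Cruxes.SuperadditiveResistance.FloatingProbeBypassLaplacian
  (integral_mul_sq_sub_gibbsMeasure pinnedChain_integral_snd_sq pinnedChain_memLp_two_snd)
open Summit.AtomisticToContinuum.FouriersLaw.Theorems.VanishingNoiseBound
  (memLp_comp_momentumFlip memLp_flipNoise flip_forwardPair gibbs_flipInvariant)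
open Summit.AtomisticToContinuum.FouriersLaw.Cruxes.NoisyFourier.AbelKapitzaEvenCorrector (stub_flipSectorGap)
open Summit.AtomisticToContinuum.FouriersLaw.Cruxes.NoisyFourier.AbelKapitzaEvenCorrector.AbelTransfer
  (memLp_totalCurrent memLp_patternAverage)
open Summit.AtomisticToContinuum.FouriersLaw.Theorems.OddResponseBound.Negative.OddPairing (sq_integral_mul_le)

namespace Summit.AtomisticToContinuum.FouriersLaw.Theorems.NoisyFourier.AbelThomson

section Chain

variable {ω₂ lam β γ : ℝ}

/-! ## Gaussian integration by parts at a bath site -/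

/-- **Stein identity at a site (Gibbs measure).** For `u ∈ C¹` with `u, ∂_{p_b}u ∈ L²(μ_T)`:
`∫ u (p_b² − T) dμ_T = T ∫ ∂_{p_b}u · p_b dμ_T` (under `μ_T` the momentum `p_b` is a centred Gaussian of variance
`T`, independent of everything else; this is the Gibbs-measure form `integral_mul_sq_sub_gibbsMeasure` of
`Kubo.gauss_ibp`, restated for `C¹` functions). [folklore] -/
theorem integral_mul_sq_momentum_sub_eq (hω : 0 < ω₂) (hl : 0 ≤ lam) (hβ : 0 ≤ β) (γ : ℝ) (L : ℕ) {T : ℝ}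
    (hT : 0 < T) (b : Fin L) {u : PhaseSpace L → ℝ} (huC : ContDiff ℝ 1 u)
    (hu2 : MemLp u 2 ((pinnedChain ω₂ lam β γ).gibbsMeasure L T))
    (hdu2 : MemLp (partialP b u) 2 ((pinnedChain ω₂ lam β γ).gibbsMeasure L T)) :
    ∫ x, u x * (x.2 b ^ 2 - T) ∂((pinnedChain ω₂ lam β γ).gibbsMeasure L T) =
      T * ∫ x, partialP b u x * x.2 b ∂((pinnedChain ω₂ lam β γ).gibbsMeasure L T) :=
  integral_mul_sq_sub_gibbsMeasure hω hl hβ γ L hT b (huC.differentiable one_ne_zero) hu2 hdu2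

/-- **Charging a bath-valued defect to the bath dissipation.** For `u ∈ C¹` with `u, ∂_{p_b}u ∈ L²(μ_T)` and reals
`c, t`, `θ > 0`: `t·c·∫ u (p_b² − T) dμ_T ≤ (θ ∫ (∂_{p_b}u)² dμ_T + θ⁻¹ t² c² T³)/2` (Stein identity, Cauchy–Schwarz,
equipartition `∫ p_b² dμ_T = T`, Young). [folklore] -/
theorem mul_integral_mul_sq_momentum_sub_le (hω : 0 < ω₂) (hl : 0 ≤ lam) (hβ : 0 ≤ β) (γ : ℝ) (L : ℕ) {T : ℝ}
    (hT : 0 < T) (b : Fin L) {u : PhaseSpace L → ℝ} (huC : ContDiff ℝ 1 u)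
    (hu2 : MemLp u 2 ((pinnedChain ω₂ lam β γ).gibbsMeasure L T))
    (hdu2 : MemLp (partialP b u) 2 ((pinnedChain ω₂ lam β γ).gibbsMeasure L T)) (c t : ℝ) {θ : ℝ}
    (hθ : 0 < θ) :
    t * (c * ∫ x, u x * (x.2 b ^ 2 - T) ∂((pinnedChain ω₂ lam β γ).gibbsMeasure L T)) ≤
      (θ * ∫ x, partialP b u x ^ 2 ∂((pinnedChain ω₂ lam β γ).gibbsMeasure L T) +
        θ⁻¹ * (t ^ 2 * (c ^ 2 * T ^ 3))) / 2 := by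
  rw [integral_mul_sq_momentum_sub_eq hω hl hβ γ L hT b huC hu2 hdu2]
  have hcs := sq_integral_mul_le hdu2 (pinnedChain_memLp_two_snd hω hl hβ γ L hT b)
  rw [pinnedChain_integral_snd_sq hω hl hβ γ L hT b] at hcs
  have hD0 : 0 ≤ ∫ x, partialP b u x ^ 2 ∂((pinnedChain ω₂ lam β γ).gibbsMeasure L T) :=
    integral_nonneg fun x => sq_nonneg _
  refine mul_le_of_sq_le_mul t ?_ hD0 (by positivity) hθ
  calc (c * (T * ∫ x, partialP b u x * x.2 b ∂((pinnedChain ω₂ lam β γ).gibbsMeasure L T))) ^ 2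
      = c ^ 2 * T ^ 2 * (∫ x, partialP b u x * x.2 b ∂((pinnedChain ω₂ lam β γ).gibbsMeasure L T)) ^ 2 := by
        ring
    _ ≤ c ^ 2 * T ^ 2 * ((∫ x, partialP b u x ^ 2 ∂((pinnedChain ω₂ lam β γ).gibbsMeasure L T)) * T) :=
        mul_le_mul_of_nonneg_left hcs (by positivity)
    _ = (∫ x, partialP b u x ^ 2 ∂((pinnedChain ω₂ lam β γ).gibbsMeasure L T)) * (c ^ 2 * T ^ 3) := by ring

/-! ## The bath-refined level-`s` Thomson lower bound -/

/-- **Bath-refined level-`s` Thomson lower bound (linear form).** For a classical Abel corrector `u` at `s > 0`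
(`ε > 0`, `L ≥ 2`) and a test function `w ∈ C²` with `w, Xw, L_{T,T}w ∈ L²(μ_T)` whose pattern defect is the bath
function `P₀Xw = h := a(p_0² − T) + b(p_{L−1}² − T)` pointwise, for every `t : ℝ`:
`t ∫ w J dμ_T ≤ ∫ J u dμ_T + (t²/2)·(s‖w‖² + (ε/2)E(w) + γTΣ_i B_i‖∂_{p_i}w‖² + ‖Xw − h‖²/ε + (a² + b²)T²/γ)`.
Proof: the pairing identity; `⟨u, Xw⟩ = ⟨u − P₀u, Xw − h⟩ + a⟨u, p_0² − T⟩ + b⟨u, p_{L−1}² − T⟩` (pattern split of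
`⟨u, Xw − h⟩`, `P₀(Xw − h) = 0`); Cauchy–Schwarz and Young termwise, the sector gap `4‖u − P₀u‖² ≤ E(u)`, and the
two bath pieces charged to `γT‖∂_{p_0}u‖²/2`, `γT‖∂_{p_{L−1}}u‖²/2` (`mul_integral_mul_sq_momentum_sub_le`); the
`u`-side adds up to `s‖u‖²/2 + (3ε/8)E(u) + γTΣ_i B_i‖∂_{p_i}u‖² ≤ σ_L(s)` (energy identity). [folklore] -/
theorem abelThomsonBath_linear (hω : 0 < ω₂) (hl : 0 < lam) (hβ : 0 < β) (hγ : 0 < γ) {T : ℝ} (hT : 0 < T)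
    {ε : ℝ} (hε : 0 < ε) {L : ℕ} (hL : 2 ≤ L) (i0 iL : Fin L) (hi0 : i0.val = 0) (hiL : iL.val = L - 1)
    {s : ℝ} (hs : 0 < s) {u w : PhaseSpace L → ℝ}
    (huC : ContDiff ℝ 2 u) (hu2 : MemLp u 2 ((pinnedChain ω₂ lam β γ).gibbsMeasure L T))
    (hpde : ∀ x, (pinnedChain ω₂ lam β γ).flipGenerator L T T ε u x =
      s * u x - ∑ i, (pinnedChain ω₂ lam β γ).bondCurrent L i x)
    (hwC : ContDiff ℝ 2 w) (hw2 : MemLp w 2 ((pinnedChain ω₂ lam β γ).gibbsMeasure L T))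
    (hXw2 : MemLp ((pinnedChain ω₂ lam β γ).liouvillian L w) 2 ((pinnedChain ω₂ lam β γ).gibbsMeasure L T))
    (hGw2 : MemLp ((pinnedChain ω₂ lam β γ).generator L T T w) 2 ((pinnedChain ω₂ lam β γ).gibbsMeasure L T))
    (a b : ℝ)
    (hdef : ∀ x : PhaseSpace L, (∑ σ : Fin L → Bool, (pinnedChain ω₂ lam β γ).liouvillian L w
        (x.1, fun i => if σ i then -x.2 i else x.2 i)) / 2 ^ L =
      a * (x.2 i0 ^ 2 - T) + b * (x.2 iL ^ 2 - T))
    (t : ℝ) :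
    t * ∫ x, w x * (∑ i, (pinnedChain ω₂ lam β γ).bondCurrent L i x) ∂((pinnedChain ω₂ lam β γ).gibbsMeasure L T) ≤
      (∫ x, (∑ i, (pinnedChain ω₂ lam β γ).bondCurrent L i x) * u x ∂((pinnedChain ω₂ lam β γ).gibbsMeasure L T)) +
        t ^ 2 / 2 * (s * ∫ x, w x ^ 2 ∂((pinnedChain ω₂ lam β γ).gibbsMeasure L T) +
          ε / 2 * ∑ i, ∫ x, (w (momentumFlip i x) - w x) ^ 2 ∂((pinnedChain ω₂ lam β γ).gibbsMeasure L T) +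
          γ * T * ∑ i, OscillatorChain.bathWeight L i *
            ∫ x, partialP i w x ^ 2 ∂((pinnedChain ω₂ lam β γ).gibbsMeasure L T) +
          1 / ε * ∫ x, ((pinnedChain ω₂ lam β γ).liouvillian L w x -
            (a * (x.2 i0 ^ 2 - T) + b * (x.2 iL ^ 2 - T))) ^ 2
              ∂((pinnedChain ω₂ lam β γ).gibbsMeasure L T) +
          1 / γ * ((a ^ 2 + b ^ 2) * T ^ 2)) := by
  -- the identities (stated before abbreviating, so that `set` rewrites them)
  have hJ2 := memLp_totalCurrent hω hl.le hβ.le γ L hT (T := T)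
  have hE := corrector_energy_eq hω hl hβ hγ hT ε hJ2 huC hu2 hpde
  have hI := pairing_identity hω hl hβ hγ hT ε hJ2 huC hu2 hpde hwC hw2 hXw2 hGw2
  have hflip := gibbs_flipInvariant (ω₂ := ω₂) (lam := lam) (β := β) (γ := γ) L T
  have hGap := stub_flipSectorGap L ((pinnedChain ω₂ lam β γ).gibbsMeasure L T) hflip u hu2
  have huC1 : ContDiff ℝ 1 u := huC.of_le (by norm_cast)
  set P := pinnedChain ω₂ lam β γ with hP
  set μ := P.gibbsMeasure L T with hμ
  set B := OscillatorChain.bathWeight L with hB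
  set g : PhaseSpace L → ℝ := P.liouvillian L w with hg
  set h : PhaseSpace L → ℝ := fun x => a * (x.2 i0 ^ 2 - T) + b * (x.2 iL ^ 2 - T) with hh
  set pu : PhaseSpace L → ℝ := fun x =>
    (∑ σ : Fin L → Bool, u (x.1, fun i => if σ i then -x.2 i else x.2 i)) / 2 ^ L with hpu
  have hB0 : ∀ i, 0 ≤ B i := Literature.MathematicalPhysics.KineticTheory.HeatConduction.bathWeight_nonneg L
  -- the two bath sites
  have hne : i0 ≠ iL := by
    intro e
    have := congrArg Fin.val e
    omega
  have hBi0 : B i0 = 1 := by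
    show ((if i0.val = 0 then (1 : ℝ) else 0) + if i0.val = L - 1 then (1 : ℝ) else 0) = 1
    rw [if_pos hi0, if_neg (show i0.val ≠ L - 1 by omega), add_zero]
  have hBiL : B iL = 1 := by
    show ((if iL.val = 0 then (1 : ℝ) else 0) + if iL.val = L - 1 then (1 : ℝ) else 0) = 1
    rw [if_neg (show iL.val ≠ 0 by omega), if_pos hiL, zero_add]
  -- square integrability of the players
  have hSu2 : MemLp (flipNoise L u) 2 μ := memLp_flipNoise hflip hu2
  set kf : PhaseSpace L → ℝ := fun x => ((∑ i, P.bondCurrent L i x) - s * u x) + ε * flipNoise L u x with hkf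
  have hkf2 : MemLp kf 2 μ := (hJ2.sub (hu2.const_mul s)).add (hSu2.const_mul ε)
  have hpu' : ∀ x, 1 * liouvilleOp P L u x + γ * bathOp L B T u x = -kf x := fun x =>
    flip_forwardPair (ω₂ := ω₂) (lam := lam) (β := β) (γ := γ) L T ε
      (k := fun y => (∑ i, P.bondCurrent L i y) - s * u y)
      (fun y => by
        show P.flipGenerator L T T ε u y = -((∑ i, P.bondCurrent L i y) - s * u y)
        rw [hpde y]
        ring) x
  set kw : PhaseSpace L → ℝ := fun x => -P.generator L T T w x with hkw
  have hkw2 : MemLp kw 2 μ := hGw2.neg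
  have hpw : ∀ x, 1 * liouvilleOp P L w x + γ * bathOp L B T w x = -kw x := by
    intro x
    simp only [hkw, neg_neg]
    rw [generator_eq_liouvilleOp_add_bathOp]
    show 1 * liouvilleOp P L w x + γ * bathOp L B T w x = liouvilleOp P L w x + γ * bathOp L B T w x
    ring
  have hdu2 : ∀ i, 0 < B i → MemLp (partialP i u) 2 μ := fun i hi =>
    memLp_partialP hω hl.le hβ.le γ L hT B hB0 1 hγ huC hu2 hkf2 hpu' hi
  have hdw2 : ∀ i, 0 < B i → MemLp (partialP i w) 2 μ := fun i hi =>
    memLp_partialP hω hl.le hβ.le γ L hT B hB0 1 hγ hwC hw2 hkw2 hpw hi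
  have hdu0 : MemLp (partialP i0 u) 2 μ := hdu2 i0 (by rw [hBi0]; exact one_pos)
  have hduL : MemLp (partialP iL u) 2 μ := hdu2 iL (by rw [hBiL]; exact one_pos)
  have hui : ∀ i, MemLp (fun x => u (momentumFlip i x) - u x) 2 μ := fun i =>
    (memLp_comp_momentumFlip hflip hu2 i).sub hu2
  have hwi : ∀ i, MemLp (fun x => w (momentumFlip i x) - w x) 2 μ := fun i =>
    (memLp_comp_momentumFlip hflip hw2 i).sub hw2
  have hg2 : MemLp g 2 μ := hXw2
  have hkin : ∀ i : Fin L, MemLp (fun x : PhaseSpace L => x.2 i ^ 2 - T) 2 μ := fun i =>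
    memLp_kinetic hω hl.le hβ.le L hT i
  have hh2 : MemLp h 2 μ := by
    have := ((hkin i0).const_mul a).add ((hkin iL).const_mul b)
    exact this
  have hgh2 : MemLp (fun x => g x - h x) 2 μ := hg2.sub hh2
  have hpu2 : MemLp pu 2 μ := memLp_patternAverage hflip hu2
  have hupu2 : MemLp (fun x => u x - pu x) 2 μ := hu2.sub hpu2
  -- nonnegativity
  have hEu0 : 0 ≤ ∑ i, ∫ x, (u (momentumFlip i x) - u x) ^ 2 ∂μ :=
    Finset.sum_nonneg fun i _ => integral_nonneg fun x => sq_nonneg _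
  have hU20 : 0 ≤ ∫ x, u x ^ 2 ∂μ := integral_nonneg fun x => sq_nonneg _
  have hUpu0 : 0 ≤ ∫ x, (u x - pu x) ^ 2 ∂μ := integral_nonneg fun x => sq_nonneg _
  -- term 1: `t·s⟨u,w⟩`
  have h1 : t * ∫ x, u x * w x ∂μ ≤ (1 * ∫ x, u x ^ 2 ∂μ + 1⁻¹ * (t ^ 2 * ∫ x, w x ^ 2 ∂μ)) / 2 :=
    mul_le_of_sq_le_mul t (sq_integral_mul_le hu2 hw2) hU20 (integral_nonneg fun x => sq_nonneg _) one_pos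
  have h1s := mul_le_mul_of_nonneg_left h1 hs.le
  -- term 2: the polarised flip Dirichlet form
  have h2 : t * ∑ i, ∫ x, (u (momentumFlip i x) - u x) * (w (momentumFlip i x) - w x) ∂μ ≤
      ((∑ i, ∫ x, (u (momentumFlip i x) - u x) ^ 2 ∂μ) +
        t ^ 2 * ∑ i, ∫ x, (w (momentumFlip i x) - w x) ^ 2 ∂μ) / 2 := by
    have h2i : ∀ i, t * ∫ x, (u (momentumFlip i x) - u x) * (w (momentumFlip i x) - w x) ∂μ ≤
        (1 * ∫ x, (u (momentumFlip i x) - u x) ^ 2 ∂μ +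
          1⁻¹ * (t ^ 2 * ∫ x, (w (momentumFlip i x) - w x) ^ 2 ∂μ)) / 2 := fun i =>
      mul_le_of_sq_le_mul t (sq_integral_mul_le (hui i) (hwi i)) (integral_nonneg fun x => sq_nonneg _)
        (integral_nonneg fun x => sq_nonneg _) one_pos
    calc t * ∑ i, ∫ x, (u (momentumFlip i x) - u x) * (w (momentumFlip i x) - w x) ∂μ
        = ∑ i, t * ∫ x, (u (momentumFlip i x) - u x) * (w (momentumFlip i x) - w x) ∂μ := Finset.mul_sum _ _ _
      _ ≤ ∑ i, (1 * ∫ x, (u (momentumFlip i x) - u x) ^ 2 ∂μ +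
          1⁻¹ * (t ^ 2 * ∫ x, (w (momentumFlip i x) - w x) ^ 2 ∂μ)) / 2 := Finset.sum_le_sum fun i _ => h2i i
      _ = ((∑ i, ∫ x, (u (momentumFlip i x) - u x) ^ 2 ∂μ) +
          t ^ 2 * ∑ i, ∫ x, (w (momentumFlip i x) - w x) ^ 2 ∂μ) / 2 := by
          rw [Finset.mul_sum, ← Finset.sum_add_distrib, Finset.sum_div]
          exact Finset.sum_congr rfl fun i _ => by ring
  have h2e := mul_le_mul_of_nonneg_left h2 (by positivity : (0 : ℝ) ≤ ε / 2)
  -- term 4: the bath Dirichlet form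
  have h4 : t * ∑ i, B i * ∫ x, partialP i u x * partialP i w x ∂μ ≤
      ((∑ i, B i * ∫ x, partialP i u x ^ 2 ∂μ) + t ^ 2 * ∑ i, B i * ∫ x, partialP i w x ^ 2 ∂μ) / 2 := by
    have h4i : ∀ i, t * (B i * ∫ x, partialP i u x * partialP i w x ∂μ) ≤
        B i * ((1 * ∫ x, partialP i u x ^ 2 ∂μ + 1⁻¹ * (t ^ 2 * ∫ x, partialP i w x ^ 2 ∂μ)) / 2) := by
      intro i
      rcases (hB0 i).eq_or_lt with h0 | hpos
      · rw [← h0]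
        simp
      · have h := mul_le_of_sq_le_mul t (sq_integral_mul_le (hdu2 i hpos) (hdw2 i hpos))
          (integral_nonneg fun x => sq_nonneg _) (integral_nonneg fun x => sq_nonneg _) one_pos
        calc t * (B i * ∫ x, partialP i u x * partialP i w x ∂μ)
            = B i * (t * ∫ x, partialP i u x * partialP i w x ∂μ) := by ring
          _ ≤ _ := mul_le_mul_of_nonneg_left h hpos.le
    calc t * ∑ i, B i * ∫ x, partialP i u x * partialP i w x ∂μ
        = ∑ i, t * (B i * ∫ x, partialP i u x * partialP i w x ∂μ) := Finset.mul_sum _ _ _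
      _ ≤ ∑ i, B i * ((1 * ∫ x, partialP i u x ^ 2 ∂μ + 1⁻¹ * (t ^ 2 * ∫ x, partialP i w x ^ 2 ∂μ)) / 2) :=
          Finset.sum_le_sum fun i _ => h4i i
      _ = ((∑ i, B i * ∫ x, partialP i u x ^ 2 ∂μ) + t ^ 2 * ∑ i, B i * ∫ x, partialP i w x ^ 2 ∂μ) / 2 := by
          rw [Finset.mul_sum, ← Finset.sum_add_distrib, Finset.sum_div]
          exact Finset.sum_congr rfl fun i _ => by ring
  have h4g := mul_le_mul_of_nonneg_left h4 (by positivity : (0 : ℝ) ≤ γ * T)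
  -- term 3: `⟨u, Xw⟩ = ⟨u − P₀u, Xw − h⟩ + a⟨u, p_0² − T⟩ + b⟨u, p_{L−1}² − T⟩`
  have hhσ : ∀ (σ : Fin L → Bool) (x : PhaseSpace L),
      h (x.1, fun i => if σ i then -x.2 i else x.2 i) = h x := by
    intro σ x
    simp only [hh]
    split_ifs <;> ring
  have hP0 : ∀ x : PhaseSpace L, (∑ σ : Fin L → Bool, (g (x.1, fun i => if σ i then -x.2 i else x.2 i) -
      h (x.1, fun i => if σ i then -x.2 i else x.2 i))) / 2 ^ L = 0 := by
    intro x
    rw [Finset.sum_sub_distrib, sub_div, hdef x]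
    simp only [hhσ, Finset.sum_const, Finset.card_univ, Fintype.card_fun, Fintype.card_bool, Fintype.card_fin,
      nsmul_eq_mul, Nat.cast_pow, Nat.cast_ofNat]
    rw [mul_div_cancel_left₀ _ (by positivity : (2 : ℝ) ^ L ≠ 0), hh]
    ring
  have hSplit : ∫ x, u x * (g x - h x) ∂μ = (∫ x, (u x - pu x) * (g x - h x) ∂μ) +
      ∫ x, pu x * ((∑ σ : Fin L → Bool, (g (x.1, fun i => if σ i then -x.2 i else x.2 i) -
        h (x.1, fun i => if σ i then -x.2 i else x.2 i))) / 2 ^ L) ∂μ :=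
    integral_mul_pattern_split hflip hu2 hgh2
  have hP0int : ∫ x, pu x * ((∑ σ : Fin L → Bool, (g (x.1, fun i => if σ i then -x.2 i else x.2 i) -
      h (x.1, fun i => if σ i then -x.2 i else x.2 i))) / 2 ^ L) ∂μ = 0 := by
    simp only [hP0, mul_zero, integral_zero]
  have iug : Integrable (fun x => u x * g x) μ := hu2.integrable_mul hg2
  have iuh : Integrable (fun x => u x * h x) μ := hu2.integrable_mul hh2
  have iuk0 : Integrable (fun x => u x * (x.2 i0 ^ 2 - T)) μ := hu2.integrable_mul (hkin i0)
  have iukL : Integrable (fun x => u x * (x.2 iL ^ 2 - T)) μ := hu2.integrable_mul (hkin iL)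
  have e1 : ∫ x, u x * (g x - h x) ∂μ = (∫ x, u x * g x ∂μ) - ∫ x, u x * h x ∂μ := by
    rw [← integral_sub iug iuh]
    exact integral_congr_ae (ae_of_all _ fun x => by ring)
  have e2 : ∫ x, u x * h x ∂μ = a * ∫ x, u x * (x.2 i0 ^ 2 - T) ∂μ + b * ∫ x, u x * (x.2 iL ^ 2 - T) ∂μ := by
    rw [← integral_const_mul, ← integral_const_mul, ← integral_add (iuk0.const_mul a) (iukL.const_mul b)]
    exact integral_congr_ae (ae_of_all _ fun x => by simp only [hh]; ring)
  have h3 : ∫ x, u x * g x ∂μ = (∫ x, (u x - pu x) * (g x - h x) ∂μ) +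
      a * ∫ x, u x * (x.2 i0 ^ 2 - T) ∂μ + b * ∫ x, u x * (x.2 iL ^ 2 - T) ∂μ := by
    linarith [e1, e2, hSplit, hP0int]
  have h3a : t * ∫ x, (u x - pu x) * (g x - h x) ∂μ ≤
      (ε * ∫ x, (u x - pu x) ^ 2 ∂μ + ε⁻¹ * (t ^ 2 * ∫ x, (g x - h x) ^ 2 ∂μ)) / 2 :=
    mul_le_of_sq_le_mul t (sq_integral_mul_le hupu2 hgh2) hUpu0 (integral_nonneg fun x => sq_nonneg _) hε
  have hgapε := mul_le_mul_of_nonneg_left hGap hε.le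
  have h3c := mul_integral_mul_sq_momentum_sub_le hω hl.le hβ.le γ L hT i0 huC1 hu2 hdu0 a t (mul_pos hγ hT)
  have h3d := mul_integral_mul_sq_momentum_sub_le hω hl.le hβ.le γ L hT iL huC1 hu2 hduL b t (mul_pos hγ hT)
  have eγ : ∀ c : ℝ, (γ * T)⁻¹ * (t ^ 2 * (c ^ 2 * T ^ 3)) = γ⁻¹ * (t ^ 2 * (c ^ 2 * T ^ 2)) := fun c => by
    field_simp
  rw [eγ a] at h3c
  rw [eγ b] at h3d
  -- the two bath pieces fit in the bath dissipation
  have hD2 : B i0 * ∫ x, partialP i0 u x ^ 2 ∂μ + B iL * ∫ x, partialP iL u x ^ 2 ∂μ ≤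
      ∑ i, B i * ∫ x, partialP i u x ^ 2 ∂μ :=
    Finset.add_le_sum (f := fun i => B i * ∫ x, partialP i u x ^ 2 ∂μ)
      (fun i _ => mul_nonneg (hB0 i) (integral_nonneg fun x => sq_nonneg _))
      (Finset.mem_univ _) (Finset.mem_univ _) hne
  rw [hBi0, hBiL, one_mul, one_mul] at hD2
  have hγTD := mul_le_mul_of_nonneg_left hD2 (mul_pos hγ hT).le
  have hsU2 : 0 ≤ s * ∫ x, u x ^ 2 ∂μ := mul_nonneg hs.le hU20
  have hεEu : 0 ≤ ε * ∑ i, ∫ x, (u (momentumFlip i x) - u x) ^ 2 ∂μ := mul_nonneg hε.le hEu0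
  -- assemble
  have hcomm : ∫ x, (∑ i, P.bondCurrent L i x) * u x ∂μ = ∫ x, u x * (∑ i, P.bondCurrent L i x) ∂μ :=
    integral_congr_ae (ae_of_all _ fun x => by ring)
  have hIt : t * ∫ x, w x * (∑ i, P.bondCurrent L i x) ∂μ =
      t * (s * ∫ x, u x * w x ∂μ +
        ε / 2 * ∑ i, ∫ x, (u (momentumFlip i x) - u x) * (w (momentumFlip i x) - w x) ∂μ +
        ∫ x, u x * g x ∂μ + γ * T * ∑ i, B i * ∫ x, partialP i u x * partialP i w x ∂μ) := by
    rw [hI]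
  have key : t * ∫ x, w x * (∑ i, P.bondCurrent L i x) ∂μ ≤
      (∫ x, (∑ i, P.bondCurrent L i x) * u x ∂μ) +
        t ^ 2 / 2 * (s * ∫ x, w x ^ 2 ∂μ + ε / 2 * ∑ i, ∫ x, (w (momentumFlip i x) - w x) ^ 2 ∂μ +
          γ * T * ∑ i, B i * ∫ x, partialP i w x ^ 2 ∂μ + ε⁻¹ * ∫ x, (g x - h x) ^ 2 ∂μ +
          γ⁻¹ * ((a ^ 2 + b ^ 2) * T ^ 2)) := by
    rw [hcomm, hIt, h3]
    simp only [inv_one, one_mul] at h1s h2e h4g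
    linarith [h1s, h2e, h4g, h3a, h3c, h3d, hgapε, hγTD, hsU2, hεEu, hE]
  rw [one_div, one_div]
  exact key

/-- **Bath-refined level-`s` Thomson lower bound (quadratic form).** In the setting of `abelThomsonBath_linear`:
`(∫ w J dμ_T)² ≤ 2 (∫ J u dμ_T) · Q^bath_s(w)`,
`Q^bath_s(w) = s‖w‖² + (ε/2)E(w) + γTΣ_i B_i‖∂_{p_i}w‖² + ‖Xw − h‖²/ε + (a² + b²)T²/γ` (optimise `t`: non-positive
discriminant). Every cost is uniform in `s ∈ (0,1]`, so a witness family with extensive pairing and extensive costs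
gives an `s`-UNIFORM extensive floor on `σ_L(s)` (stub A7). [folklore] -/
theorem abelThomsonBath_sq (hω : 0 < ω₂) (hl : 0 < lam) (hβ : 0 < β) (hγ : 0 < γ) {T : ℝ} (hT : 0 < T)
    {ε : ℝ} (hε : 0 < ε) {L : ℕ} (hL : 2 ≤ L) (i0 iL : Fin L) (hi0 : i0.val = 0) (hiL : iL.val = L - 1)
    {s : ℝ} (hs : 0 < s) {u w : PhaseSpace L → ℝ}
    (huC : ContDiff ℝ 2 u) (hu2 : MemLp u 2 ((pinnedChain ω₂ lam β γ).gibbsMeasure L T))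
    (hpde : ∀ x, (pinnedChain ω₂ lam β γ).flipGenerator L T T ε u x =
      s * u x - ∑ i, (pinnedChain ω₂ lam β γ).bondCurrent L i x)
    (hwC : ContDiff ℝ 2 w) (hw2 : MemLp w 2 ((pinnedChain ω₂ lam β γ).gibbsMeasure L T))
    (hXw2 : MemLp ((pinnedChain ω₂ lam β γ).liouvillian L w) 2 ((pinnedChain ω₂ lam β γ).gibbsMeasure L T))
    (hGw2 : MemLp ((pinnedChain ω₂ lam β γ).generator L T T w) 2 ((pinnedChain ω₂ lam β γ).gibbsMeasure L T))
    (a b : ℝ)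
    (hdef : ∀ x : PhaseSpace L, (∑ σ : Fin L → Bool, (pinnedChain ω₂ lam β γ).liouvillian L w
        (x.1, fun i => if σ i then -x.2 i else x.2 i)) / 2 ^ L =
      a * (x.2 i0 ^ 2 - T) + b * (x.2 iL ^ 2 - T)) :
    (∫ x, w x * (∑ i, (pinnedChain ω₂ lam β γ).bondCurrent L i x) ∂((pinnedChain ω₂ lam β γ).gibbsMeasure L T)) ^ 2 ≤
      2 * (∫ x, (∑ i, (pinnedChain ω₂ lam β γ).bondCurrent L i x) * u x ∂((pinnedChain ω₂ lam β γ).gibbsMeasure L T)) *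
        (s * ∫ x, w x ^ 2 ∂((pinnedChain ω₂ lam β γ).gibbsMeasure L T) +
          ε / 2 * ∑ i, ∫ x, (w (momentumFlip i x) - w x) ^ 2 ∂((pinnedChain ω₂ lam β γ).gibbsMeasure L T) +
          γ * T * ∑ i, OscillatorChain.bathWeight L i *
            ∫ x, partialP i w x ^ 2 ∂((pinnedChain ω₂ lam β γ).gibbsMeasure L T) +
          1 / ε * ∫ x, ((pinnedChain ω₂ lam β γ).liouvillian L w x -
            (a * (x.2 i0 ^ 2 - T) + b * (x.2 iL ^ 2 - T))) ^ 2
              ∂((pinnedChain ω₂ lam β γ).gibbsMeasure L T) +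
          1 / γ * ((a ^ 2 + b ^ 2) * T ^ 2)) := by
  have h := abelThomsonBath_linear hω hl hβ hγ hT hε hL i0 iL hi0 hiL hs huC hu2 hpde hwC hw2 hXw2 hGw2 a b hdef
  set A := ∫ x, w x * (∑ i, (pinnedChain ω₂ lam β γ).bondCurrent L i x) ∂((pinnedChain ω₂ lam β γ).gibbsMeasure L T)
  set σ := ∫ x, (∑ i, (pinnedChain ω₂ lam β γ).bondCurrent L i x) * u x ∂((pinnedChain ω₂ lam β γ).gibbsMeasure L T)
  set Q := s * ∫ x, w x ^ 2 ∂((pinnedChain ω₂ lam β γ).gibbsMeasure L T) +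
          ε / 2 * ∑ i, ∫ x, (w (momentumFlip i x) - w x) ^ 2 ∂((pinnedChain ω₂ lam β γ).gibbsMeasure L T) +
          γ * T * ∑ i, OscillatorChain.bathWeight L i *
            ∫ x, partialP i w x ^ 2 ∂((pinnedChain ω₂ lam β γ).gibbsMeasure L T) +
          1 / ε * ∫ x, ((pinnedChain ω₂ lam β γ).liouvillian L w x -
            (a * (x.2 i0 ^ 2 - T) + b * (x.2 iL ^ 2 - T))) ^ 2
              ∂((pinnedChain ω₂ lam β γ).gibbsMeasure L T) +
          1 / γ * ((a ^ 2 + b ^ 2) * T ^ 2)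
  have hquad : ∀ t : ℝ, 0 ≤ Q / 2 * (t * t) + (-A) * t + σ := fun t => by nlinarith [h t]
  have hd := discrim_le_zero hquad
  rw [discrim] at hd
  nlinarith [hd]

end Chain

/-! ## Registered helper (notation-free restatement) -/

/-- Registered helper sub-goal `helper_abelThomsonBath` of crux stmt-AtomisticToContinuum-11977 (line
`abel-storage-decay`, stubs B `stub_bulkAbelGKPositivity` / A7 `stub_thomsonFloor`): the bath-refined level-`s`
Thomson lower bound `abelThomsonBath_sq`, restated. [folklore] -/
theorem helper_abelThomsonBath : ∀ (ω₂ lam β γ T ε : ℝ), 0 < ω₂ → 0 < lam → 0 < β → 0 < γ → 0 < T → 0 < ε → ∀ (L : ℕ), 2 ≤ L → ∀ (i0 iL : Fin L), i0.val = 0 → iL.val = L - 1 → ∀ (s : ℝ), 0 < s → ∀ (u w : Literature.MathematicalPhysics.KineticTheory.HeatConduction.PhaseSpace L → ℝ), (ContDiff ℝ 2 u ∧ MeasureTheory.MemLp u 2 ((Literature.MathematicalPhysics.KineticTheory.HeatConduction.pinnedChain ω₂ lam β γ).gibbsMeasure L T) ∧ ∀ x, (Literature.MathematicalPhysics.KineticTheory.HeatConduction.pinnedChain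 ω₂ lam β γ).flipGenerator L T T ε u x = s * u x - ∑ i : Fin L, (Literature.MathematicalPhysics.KineticTheory.HeatConduction.pinnedChain ω₂ lam β γ).bondCurrent L i x) → ContDiff ℝ 2 w → MeasureTheory.MemLp w 2 ((Literature.MathematicalPhysics.KineticTheory.HeatConduction.pinnedChain ω₂ lam β γ).gibbsMeasure L T) → MeasureTheory.MemLp ((Literature.MathematicalPhysics.KineticTheory.HeatConduction.pinnedChain ω₂ lam β γ).liouvillian L w) 2 ((Literature.MathematicalPhysics.KineticTheory.HeatConduction.pinnedChain ω₂ lam β γ).gibbsMeasure L T) → MeasureTheory.MemLp ((Literature.MathematicalPhysics.KineticTheory.HeatConduction.pinnedChain ω₂ lam β γ).generator L T T w) 2 ((Literature.MathematicalPhysics.KineticTheory.HeatConduction.pinnedChain ω₂ lam β γ).gibbsMeasure L T) → ∀ (a b : ℝ), (∀ x : Literature.MathematicalPhysics.KineticTheory.HeatConduction.PhaseSpace L, (∑ σ : Fin L → Bool, (Literature.MathematicalPhysics.KineticTheory.HeatConduction.pinnedChain ω₂ lam β γ).liouvillian L w (x.1, fun i => if σ i then -x.2 i else x.2 i)) / 2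 ^ L = a * (x.2 i0 ^ 2 - T) + b * (x.2 iL ^ 2 - T)) → (MeasureTheory.integral ((Literature.MathematicalPhysics.KineticTheory.HeatConduction.pinnedChain ω₂ lam β γ).gibbsMeasure L T) (fun x => w x * ∑ i : Fin L, (Literature.MathematicalPhysics.KineticTheory.HeatConduction.pinnedChain ω₂ lam β γ).bondCurrent L i x)) ^ 2 ≤ 2 * MeasureTheory.integral ((Literature.MathematicalPhysics.KineticTheory.HeatConduction.pinnedChain ω₂ lam β γ).gibbsMeasure L T) (fun x => (∑ i : Fin L, (Literature.MathematicalPhysics.KineticTheory.HeatConduction.pinnedChain ω₂ lam β γ).bondCurrent L i x) * u x) * (s * MeasureTheory.integral ((Literature.MathematicalPhysics.KineticTheory.HeatConduction.pinnedChain ω₂ lam β γ).gibbsMeasure L T) (fun x => w x ^ 2) + ε / 2 * ∑ i : Fin L, MeasureTheory.integral ((Literature.MathematicalPhysics.KineticTheory.HeatConduction.pinnedChain ω₂ lam β γ).gibbsMeasure L T) (fun x => (w (Literature.MathematicalPhysics.KineticTheory.HeatConduction.momentumFlip i x) - w x) ^ 2) + γ * T * ∑ i : Fin L, Literature.MathematicalPhysics.KineticTheory.HeatConduction.OscillatorChain.bathWeight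 L i * MeasureTheory.integral ((Literature.MathematicalPhysics.KineticTheory.HeatConduction.pinnedChain ω₂ lam β γ).gibbsMeasure L T) (fun x => (Literature.MathematicalPhysics.KineticTheory.HeatConduction.partialP i w x) ^ 2) + 1 / ε * MeasureTheory.integral ((Literature.MathematicalPhysics.KineticTheory.HeatConduction.pinnedChain ω₂ lam β γ).gibbsMeasure L T) (fun x => ((Literature.MathematicalPhysics.KineticTheory.HeatConduction.pinnedChain ω₂ lam β γ).liouvillian L w x - (a * (x.2 i0 ^ 2 - T) + b * (x.2 iL ^ 2 - T))) ^ 2) + 1 / γ * ((a ^ 2 + b ^ 2) * T ^ 2)) :=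
  fun _ _ _ _ _ _ hω hl hβ hγ hT hε _ hL i0 iL hi0 hiL _ hs _ _ hu hwC hw2 hXw2 hGw2 a b hdef =>
    abelThomsonBath_sq hω hl hβ hγ hT hε hL i0 iL hi0 hiL hs hu.1 hu.2.1 hu.2.2 hwC hw2 hXw2 hGw2 a b hdef

end Summit.AtomisticToContinuum.FouriersLaw.Theorems.NoisyFourier.AbelThomson

end
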